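import Summits.QuantumFields.YangMills.Theses.DoublingDefect
import Summits.QuantumFields.YangMills.Theorems.BrascampLiebVacuumSC.Negative.AdmissibleInstance

/-!
# Crux attack at birth — `DoublingDefect.OneTorusExit` (stmt-QuantumFields-17753): Lean probes

* `Z`, `δ` : the route's inlined torus partition function / purity defect, copied verbatim;
  `oneTorusExit_iff` : the crux is literally the statement over these carriers (`Iff.rfl`).
* `Z_zero_side` : `Z β 0 t = 1` (empty torus) ⇒ `δ β 0 = 0` (`delta_zero`).
* `oneTorusExit_trivial_without_L₀` : HYPOTHESIS MUTATION — deleting the clause `L₀ ≤ L`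
  (equivalently `L₀ = 0`) makes the exit trivially true with witness `L = 0`; so the `∀ L₀` guard is
  load-bearing and correctly placed (no degenerate witness survives it).
* `nonvacuous` : the hypotheses `IsCompactSimpleLieGroup G ∧ SimplyConnectedSpace G ∧ LatticeRep G`
  are satisfiable by a certified instance (`SU(2)`, fundamental; tree theorem
  `exists_admissible_simplyConnected`), so the crux is not true for lack of instances.
-/

noncomputable section

namespace Summit.QuantumFields.YangMills.Cruxes.OneTorusExit.Probes

open MeasureTheory Literature.MathematicalPhysics.QuantumFieldTheory
open Summit.QuantumFields.YangMills.Theses.DoublingDefect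

variable (G : Type) [Group G] [TopologicalSpace G] [IsTopologicalGroup G] [CompactSpace G]
  [MeasurableSpace G] [BorelSpace G]

/-- The route's inlined anisotropic-torus Wilson partition function `Z_β(a,a,a,t)` (verbatim). -/
def Z (r : LatticeRep G) (β : ℝ) (a t : ℕ) : ℝ :=
  let St := Fin a × Fin a × Fin a × Fin t
  let sh : St → Fin 4 → St := fun x μ => ![(finRotate a x.1, x.2.1, x.2.2.1, x.2.2.2),
    (x.1, finRotate a x.2.1, x.2.2.1, x.2.2.2), (x.1, x.2.1, finRotate a x.2.2.1, x.2.2.2),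
    (x.1, x.2.1, x.2.2.1, finRotate t x.2.2.2)] μ
  let pl : (St × Fin 4 → G) → St → Fin 4 → Fin 4 → G := fun U x μ ν =>
    U (x, μ) * U (sh x μ, ν) * (U (sh x ν, μ))⁻¹ * (U (x, ν))⁻¹
  ∫ U, Real.exp (-β * ∑ x : St, ∑ q : {q : Fin 4 × Fin 4 // q.1 < q.2},
    ((r.N : ℝ) - (r.ρ (pl U x q.1.1 q.1.2)).trace.re))
    ∂(Measure.pi fun _ : St × Fin 4 => haarProbability G)

/-- The route's purity / period-doubling defect `δ_β(L) = 1 − Z(L,2L)/Z(L,L)²` (verbatim). -/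
def δ (r : LatticeRep G) (β : ℝ) (L : ℕ) : ℝ := 1 - Z G r β L (2 * L) / (Z G r β L L) ^ 2

/-- The crux is, definitionally, the statement over the carriers `Z`, `δ`. -/
theorem oneTorusExit_iff :
    OneTorusExit ↔ ∀ (G : Type) [Group G] [TopologicalSpace G] [IsTopologicalGroup G]
      [CompactSpace G] [MeasurableSpace G] [BorelSpace G],
      IsCompactSimpleLieGroup G → SimplyConnectedSpace G → ∀ r : LatticeRep G,
      ∀ ε : ℝ, 0 < ε → ∃ β₁ : ℝ, ∀ β : ℝ, β₁ ≤ β → ∀ L₀ : ℕ, ∃ L : ℕ, L₀ ≤ L ∧ δ G r β L ≤ ε :=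
  Iff.rfl

/-- `haarProbability G` is a probability measure (`haarMeasure_self` with `K₀ = ⊤`). -/
instance isProbabilityMeasure_haarProbability : IsProbabilityMeasure (haarProbability G) :=
  ⟨by simpa [haarProbability] using Measure.haarMeasure_self (G := G) (K₀ := ⊤)⟩

/-- DEGENERATE SCALE: on the empty torus (`a = 0`) the action is an empty sum, `Z = 1`. -/
theorem Z_zero_side (r : LatticeRep G) (β : ℝ) (t : ℕ) : Z G r β 0 t = 1 := by
  simp [Z]

/-- Hence `δ_β(0) = 1 − 1/1² = 0` for every `β`. -/
theorem delta_zero (r : LatticeRep G) (β : ℝ) : δ G r β 0 = 0 := by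
  simp [δ, Z_zero_side]

/-- HYPOTHESIS MUTATION: without the clause `L₀ ≤ L` the exit is trivially true (witness `L = 0`,
for every `G`, `r`, `β`, with no group-theoretic hypothesis at all). -/
theorem oneTorusExit_trivial_without_L₀ :
    ∀ (G : Type) [Group G] [TopologicalSpace G] [IsTopologicalGroup G]
      [CompactSpace G] [MeasurableSpace G] [BorelSpace G], ∀ r : LatticeRep G,
      ∀ ε : ℝ, 0 < ε → ∀ β : ℝ, ∃ L : ℕ, δ G r β L ≤ ε := by
  intro G _ _ _ _ _ _ r ε hε β
  exact ⟨0, by rw [delta_zero]; exact hε.le⟩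

/-- … and likewise the crux restricted to `L₀ = 0` is trivial. -/
theorem oneTorusExit_trivial_at_L₀_zero :
    ∀ (G : Type) [Group G] [TopologicalSpace G] [IsTopologicalGroup G]
      [CompactSpace G] [MeasurableSpace G] [BorelSpace G], ∀ r : LatticeRep G,
      ∀ ε : ℝ, 0 < ε → ∀ β : ℝ, ∃ L : ℕ, 0 ≤ L ∧ δ G r β L ≤ ε := by
  intro G _ _ _ _ _ _ r ε hε β
  exact ⟨0, le_rfl, by rw [delta_zero]; exact hε.le⟩

/-- For `ε ≥ 1` nothing is claimed beyond `Z(L,2L)/Z(L,L)² ≥ 0`; recorded as the trivial regime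
(the content is `ε → 0`).  NON-VACUITY of the hypotheses: a certified admissible simply-connected
instance exists in the tree (`SU(2)`, fundamental representation). -/
theorem nonvacuous :
    ∃ (G : Type) (_ : Group G) (_ : TopologicalSpace G) (_ : IsTopologicalGroup G)
      (_ : CompactSpace G) (_ : MeasurableSpace G) (_ : BorelSpace G),
      IsCompactSimpleLieGroup G ∧ SimplyConnectedSpace G ∧ Nonempty (LatticeRep G) :=
  Summit.QuantumFields.YangMills.Theorems.BrascampLiebVacuumSC.Negative.exists_admissible_simplyConnected

end Summit.QuantumFields.YangMills.Cruxes.OneTorusExit.Probes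

end
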